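import Literature.MathematicalPhysics.QuantumFieldTheory.Balaban1983to89.B6SectACriticalPointV1
import Literature.MathematicalPhysics.QuantumFieldTheory.Balaban1983to89.B6SectCTwoScaleV1Lattice
import Summits.QuantumFields.YangMills.Theorems.BalabanUVNodesK0RecordFormatNamesLocC
import Summits.QuantumFields.YangMills.Theorems.BalabanUVNodesK0AxGaugeFlowRecDefs

/-!
# LENS-1 (◇ `ymgap-nodeO-lens-1` g7) — NODE v8.3: the (C-tab-uniq) ⊕ (C-tab-H) half of the table identity (C-tab), TYPED AND PROVED
# in DEF-1's operator language ([B6] Sect. A on the V1 multi-level torus calculus: `dE ∕ dsE ∕ dcE ∕ QE ∕ QpE ∕ RE ∕ GE ∕ EE ∕ hOp`)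

HOME sketch `nodeO-cover/LENS-1-CtabUniq-v1.2.lean` (= v1 34a22b19d3da8c1d + §6 (v1.1 865d0c2e1629871f, (bk-1)) + §7 APPEND-ONLY: (bk-2), the 𝐔-rows of (C-tab); imports ✓p813155 `…K0AxGaugeFlowRecDefs` for the name of record `recordGradLeg`) (count-neutral; landing, if wanted, is DEF-1's ∕ a porter's call — natural host: next to
`Literature/…/B6SectACriticalPointV1.lean` §4, or a `Summits/…/Theorems/BalabanUVNodesK0Ax…` helper).

WHAT (v8.2 §3, now kernel-checked).  The (C)♯ response row of NODE v8 reduces (RowLTRec-v1, under TokP9-reg) to the table identity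
(C-tab) «L-table − transverse table = `recordGradLeg φ`», whose 𝐔-core is «rooted response − `H₁ e_l` is a lattice gradient».  In print this is
[15] (176) p.306 («the expansion of ℋ begins with the first order term H₁B») + (21) p.281 ↔ [B6] (2.12)∕(2.35).  v8.2 split it as
(C-tab) = (C-tab-opt) ⊕ (C-tab-uniq) ⊕ (C-tab-H).  THIS FILE closes (C-tab-uniq) ⊕ (C-tab-H) as ONE theorem of linear algebra over the tree's concrete
[B6] Sect. A operators, with NO hypothesis beyond `c ≠ 0`, `w > 0`:

* §1 `WeaklyCritical D c B x` := `Q x = B ∧ ∀ v, Q v = 0 → ⟪∂x, ∂v⟫ = 0` — the GAUGE-FREE first-order optimality of the quadratic functional (2.5)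
  on the constraint surface `QA = B` (NO gauge condition (2.12); this is the linearisation at the flat point of [15] (178) p.306, the condition the
  rooted response of record can be expected to satisfy — face (C-tab-opt), OPEN·M mod P0, NOT asserted here).
* §2 ★★ `exists_gauge_eq_hOp_of_weaklyCritical`: every weakly critical `x` is `HB` UP TO A RESTRICTED GAUGE: `∃ λ ∈ N(Q′), x − ∂λ = H B`,
  `H = GQ*(QGQ*)⁻¹` = `B6SectA.hOp (GE D hc hw) (QsE D) (EE D hc hw)` ((2.35)).  Proof = the tree's (2.12) `existsUnique_gauge212` (re-gauge into
  `R∂*A = 0`) + `∂∂λ = 0` (`dcE_comp_dE`) + `Q∂λ = 0` on `N(Q′)` (`QE_dE_eq_zero`) + `isCritical_iff_eq_hOp` ((2.35) uniqueness).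
* §3 ★ `weaklyCritical_hOp` (NON-VACUITY ∕ converse): `HB` itself is weakly critical on ALL of `ker Q` (not only on the (2.12)-tangent), and
  ★★ `weaklyCritical_iff`: `WeaklyCritical B x ↔ ∃ λ ∈ N(Q′), x − ∂λ = HB`; §4 `sub_mem_of_weaklyCritical`: two weakly critical configurations with the
  same datum differ by `∂λ`, `λ ∈ N(Q′)` — (C-tab-uniq) verbatim.

CONSEQUENCE FOR (C-tab) (bookkeeping faces left to DEF-1 ∕ the JOIN, not typed here): per colour component and per real∕imaginary part, (C-tab)'s 𝐔-rows
⟸ «the chart-unit rooted response component is `WeaklyCritical` with datum the matching component of `windowSrc l`» (= (C-tab-opt)) ⊕ §2 ⊕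
«`landauRepC y − y ∈ ∂(…)`» (BIJ85 (4.42), by construction) ⊕ «`windowResp univ l = hOp … (windowSrc … l)`» (NamesLoc :104, by definition on
`k + 1 ≤ m + K`); the 𝐉-rows ⟸ the same ⊕ «the linearised current kills gradients» (J gauge-covariant, J(1) = 0; NamesL :118 docstring).

HONEST.  Linear algebra over the tree's [B6] Sect. A model; nothing of Bałaban's analytic content is asserted, ported or discharged; (C-tab-opt), P0
(HypAn), (D1) remain OPEN; K0ᴬ OPEN; NODE O 0∕1; COUNT 8∕28 · K 1∕4 unmoved; finite 𝕋⁴ ∕ fixed ε — NOT continuum ∕ OS ∕ Clay; YM mass gap NOT proved.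
LANDING NOTE (porter `ymgap-nodeO-port-PTB-1` g4, 2026-08-31): landed under ◆ CRIT-1 g35 CUT №4∕№4′ (PASS ×3) per the hosting word (06:42:49Z) as ONE Theorems file
(kind=definition: two Prop receipts + one abbrev), namespace `Summit.QuantumFields.YangMills.Theorems.K0AxCtabUniq` (was `…NodeOCover.Lens1CtabUniq`); §7's `sl2Coord_sub`, §1's `dcE_dE`, §5's `eta_pos'` DROPPED for the tree's
✓`K0AxGaugeFlowRec.sl2Coord_sub` (p813155), ✓`B6SectCTwoScaleV1Lattice.dcE_dE`, an inline `pow_pos` (gate `dedup.landed`); otherwise VERBATIM (v1.2 af048e3a5a2c359e).  `--supports stmt-QuantumFields-27238 --as helper`.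
-/

open scoped InnerProductSpace

namespace Summit.QuantumFields.YangMills.Theorems.K0AxCtabUniq

open Literature.MathematicalPhysics.QuantumFieldTheory.Balaban1983to89
open LatticeFieldCalculus B6SectADomainsV1 B6SectAOperatorsV1 B6SectAVectorModelV1 B6SectACriticalPointV1
open Literature.MathematicalPhysics.QuantumFieldTheory.BalabanImbrieJaffe1984to88.BIJ85AxialPropagator411 (BondSpace PlaqSpace)
open B6Eq218Lagrangian (IsCritical Admissible tangent mem_tangent_iff)

noncomputable section

variable {P : Params} (D : Domains P)

/-! ## §1  Gauge-free first-order optimality ([15] (178) linearised at the flat point) -/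

/-- **`WeaklyCritical D c B x`**: `x` satisfies the linearised constraint `Q x = B` and the first variation of (2.5) `‖∂A‖²` vanishes along EVERY
direction tangent to the constraint surface (`Q v = 0`) — no gauge condition imposed.  [cite: Balaban1985Variational, (178) p.306; Balaban1984PropagatorsII, (2.5)–(2.6) p.224] -/
def WeaklyCritical (c : ℝ) (B : BondIdxSpace D) (x : BondSpace P) : Prop :=
  QE D x = B ∧ ∀ v : BondSpace P, QE D v = 0 → ⟪dcE c x, dcE c v⟫_ℝ = 0

variable {D}


/-- Weak criticality is invariant under restricted gauge transformations `x ↦ x + ∂λ`, `λ ∈ N(Q′)` (gauge invariance of (2.5)–(2.6)).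
[cite: Balaban1984PropagatorsII, (2.7)–(2.8) p.224] -/
theorem weaklyCritical_add_dE {c : ℝ} {B : BondIdxSpace D} {x : BondSpace P} (h : WeaklyCritical D c B x)
    {n : ScalarSpace P} (hn : n ∈ LinearMap.ker (QpE D)) : WeaklyCritical D c B (x + dE c n) := by
  refine ⟨by rw [map_add, QE_dE_eq_zero D c n hn, add_zero, h.1], fun v hv => ?_⟩
  rw [map_add, B6SectCTwoScaleV1Lattice.dcE_dE, add_zero]
  exact h.2 v hv

/-! ## §2  ★★ Weakly critical ⟹ `HB` up to a restricted gauge ((2.12) + (2.35)) -/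

/-- ★★ **Every weakly critical configuration is `HB = GQ*(QGQ*)⁻¹B` up to a restricted gauge transformation**: re-gauge `x` into the (2.12) gauge
`R∂*A = 0` by the unique `λ₀ ∈ N(Q′)` of (2.9)–(2.12); the re-gauged configuration is admissible and critical, hence equals `HB` by (2.35).
[cite: Balaban1984PropagatorsII, (2.12) p.225, (2.35) p.228; Balaban1985Variational, (176)–(178) p.306] -/
theorem exists_gauge_eq_hOp_of_weaklyCritical {c : ℝ} (hc : c ≠ 0) {w : BondIdx D → ℝ} (hw : ∀ i, 0 < w i)
    {B : BondIdxSpace D} {x : BondSpace P} (h : WeaklyCritical D c B x) :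
    ∃ n : ScalarSpace P, n ∈ LinearMap.ker (QpE D) ∧
      x - dE c n = B6SectA.hOp (GE D hc hw) (QsE D) (EE D hc hw) B := by
  obtain ⟨n, ⟨hn, hR⟩, -⟩ := existsUnique_gauge212 D hc x
  refine ⟨n, hn, (isCritical_iff_eq_hOp D hc hw B (x - dE c n)).mp ⟨⟨?_, hR⟩, fun v hv => ?_⟩⟩
  · rw [map_sub, QE_dE_eq_zero D c n hn, sub_zero, h.1]
  · rw [map_sub, B6SectCTwoScaleV1Lattice.dcE_dE, sub_zero]
    exact h.2 v ((mem_tangent_iff _ _ _ v).mp hv).1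

/-! ## §3  ★ Non-vacuity ∕ converse: `HB` is weakly critical, and the characterisation -/

/-- ★ **`HB` is weakly critical** — its first variation vanishes on ALL of `ker Q`, not only on the (2.12)-tangent: split `v ∈ ker Q` as
`v = (v − ∂λ₀) + ∂λ₀` with `v − ∂λ₀` in the tangent ((2.12) applied to `v`) and use `∂∂λ₀ = 0`. [cite: Balaban1984PropagatorsII, (2.12) p.225, (2.35) p.228] -/
theorem weaklyCritical_hOp {c : ℝ} (hc : c ≠ 0) {w : BondIdx D → ℝ} (hw : ∀ i, 0 < w i) (B : BondIdxSpace D) :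
    WeaklyCritical D c B (B6SectA.hOp (GE D hc hw) (QsE D) (EE D hc hw) B) := by
  have hH := isCritical_hOp_V1 D hc hw B
  refine ⟨hH.1.1, fun v hv => ?_⟩
  obtain ⟨m, ⟨hm, hRm⟩, -⟩ := existsUnique_gauge212 D hc v
  have ht : v - dE c m ∈ tangent (QE D) (dsE c) (RE D c) :=
    (mem_tangent_iff _ _ _ _).mpr ⟨by rw [map_sub, QE_dE_eq_zero D c m hm, sub_zero, hv], hRm⟩
  have h0 := hH.2 (v - dE c m) ht
  rwa [map_sub, B6SectCTwoScaleV1Lattice.dcE_dE, sub_zero] at h0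

/-- ★★ **Characterisation**: `x` is weakly critical iff it is `HB` up to a restricted gauge. [cite: Balaban1984PropagatorsII, (2.12) p.225, (2.35) p.228; Balaban1985Variational, (176)–(178) p.306] -/
theorem weaklyCritical_iff {c : ℝ} (hc : c ≠ 0) {w : BondIdx D → ℝ} (hw : ∀ i, 0 < w i) (B : BondIdxSpace D) (x : BondSpace P) :
    WeaklyCritical D c B x ↔
      ∃ n : ScalarSpace P, n ∈ LinearMap.ker (QpE D) ∧ x - dE c n = B6SectA.hOp (GE D hc hw) (QsE D) (EE D hc hw) B := by
  refine ⟨exists_gauge_eq_hOp_of_weaklyCritical hc hw, fun ⟨n, hn, hx⟩ => ?_⟩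
  have hx' : x = B6SectA.hOp (GE D hc hw) (QsE D) (EE D hc hw) B + dE c n := by rw [← hx, sub_add_cancel]
  rw [hx']
  exact weaklyCritical_add_dE (weaklyCritical_hOp hc hw B) hn

/-! ## §4  (C-tab-uniq): uniqueness modulo restricted gauge -/

/-- **(C-tab-uniq)**: two weakly critical configurations with the same datum differ by a restricted gauge transformation `∂λ`, `λ ∈ N(Q′)`
(energy argument packaged through §2: both are `HB` up to gauge). [cite: Balaban1984PropagatorsII, (2.12) p.225, (2.35) p.228] -/
theorem sub_mem_of_weaklyCritical {c : ℝ} (hc : c ≠ 0) {B : BondIdxSpace D} {x y : BondSpace P}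
    (hx : WeaklyCritical D c B x) (hy : WeaklyCritical D c B y) :
    ∃ n : ScalarSpace P, n ∈ LinearMap.ker (QpE D) ∧ x - y = dE c n := by
  have hw : ∀ i : BondIdx D, 0 < (fun _ => (1 : ℝ)) i := fun _ => one_pos
  obtain ⟨n, hn, hxn⟩ := exists_gauge_eq_hOp_of_weaklyCritical hc hw hx
  obtain ⟨m, hm, hym⟩ := exists_gauge_eq_hOp_of_weaklyCritical hc hw hy
  refine ⟨n - m, Submodule.sub_mem _ hn hm, ?_⟩
  have h : x - dE c n = y - dE c m := by rw [hxn, hym]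
  rw [map_sub]
  calc x - y = (x - dE c n) - (y - dE c m) + (dE c n - dE c m) := by abel
    _ = dE c n - dE c m := by rw [h, sub_self, zero_add]

/-- **The weakly critical configuration in the (2.12) gauge is unique and equals `HB`** (the form (C-tab-H) is used in: `critical221_unique` ∕
`isCritical_iff_eq_hOp`). [cite: Balaban1984PropagatorsII, (2.35) p.228] -/
theorem eq_hOp_of_weaklyCritical_of_gauge212 {c : ℝ} (hc : c ≠ 0) {w : BondIdx D → ℝ} (hw : ∀ i, 0 < w i)
    {B : BondIdxSpace D} {x : BondSpace P} (h : WeaklyCritical D c B x) (hR : RE D c (dsE c x) = 0) :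
    x = B6SectA.hOp (GE D hc hw) (QsE D) (EE D hc hw) B :=
  (isCritical_iff_eq_hOp D hc hw B x).mp
    ⟨⟨h.1, hR⟩, fun v hv => h.2 v ((mem_tangent_iff _ _ _ v).mp hv).1⟩

/-! ## §5  AT THE RECORD'S NAMES: `windowResp univ` characterised; the receipt (C-tab-opt); the 𝐔-core of (C-tab) -/

section Record

open Summit.QuantumFields.YangMills.Theorems.K0RecordFormatNames
open Literature.MathematicalPhysics.QuantumFieldTheory.Balaban1983to89.T4Continuum (T4Family)
open Literature.MathematicalPhysics.QuantumFieldTheory.Balaban1983to89.Node00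

variable (F : T4Family)

/-- The [B6] Sect. A domain family of the WHOLE record torus: DEF-1's window family at the window `W = univ` (`Λ₀ = ∅` — nothing pinned —, `Λ_j = ∅`
for `1 ≤ j ≤ k`, `Λ_{k+1} = T^{(k+1)}`): the GLOBAL linearised (0.21) problem `min ‖∂A‖²` s.t. `Q_{k+1}A = B`. [cite: Balaban1984PropagatorsII, (2.1)–(2.6) p.224; Balaban1985Variational, (176)–(178) p.306] -/
abbrev univDomains (k K : ℕ) (hk : k + 1 ≤ (F.P K).m + (F.P K).K) : Domains (F.P K) :=
  windowDomains F k K hk Finset.univ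

/-- ★★ **`windowResp univ l` CHARACTERISED**: a real fine-bond field `x` is weakly critical for the global problem with datum `r·e_l` iff it is
`r · windowResp univ l` up to a restricted gauge transformation.  (DEF-1's name `windowResp` unfolded once, by `dif_pos hk`.)
[cite: Balaban1984PropagatorsII, (2.12) p.225, (2.35) p.228; Balaban1987RG1, (4.35) p.290] -/
theorem weaklyCritical_univ_iff (k K : ℕ) (hk : k + 1 ≤ (F.P K).m + (F.P K).K) (l : RespLabel F k K) (r : ℝ)
    (x : BondSpace (F.P K)) :
    WeaklyCritical (univDomains F k K hk) 1 (r • windowSrc F k K hk Finset.univ l) x ↔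
      ∃ n : ScalarSpace (F.P K), n ∈ LinearMap.ker (QpE (univDomains F k K hk)) ∧
        ∀ b, WithLp.ofLp (x - dE 1 n) b = r * windowResp F k K Finset.univ l b := by
  rw [weaklyCritical_iff (D := univDomains F k K hk) (one_ne_zero (α := ℝ)) (w := fun _ => (1 : ℝ)) (fun _ => one_pos)]
  refine exists_congr fun n => and_congr_right fun _ => ?_
  have hW : ∀ b, r * windowResp F k K Finset.univ l b =
      WithLp.ofLp (B6SectA.hOp (GE (univDomains F k K hk) (one_ne_zero (α := ℝ)) (w := fun _ => (1 : ℝ)) fun _ => one_pos)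
        (QsE (univDomains F k K hk)) (EE (univDomains F k K hk) (one_ne_zero (α := ℝ)) (w := fun _ => (1 : ℝ)) fun _ => one_pos)
        (r • windowSrc F k K hk Finset.univ l)) b := fun b => by
    rw [map_smul, WithLp.ofLp_smul, Pi.smul_apply, smul_eq_mul, windowResp, dif_pos hk]
  constructor
  · intro h b
    rw [h, hW]
  · intro h
    exact WithLp.ofLp_injective 2 (funext fun b => by rw [h b, hW])

variable (θ : Stage13Params F 2)

/-- ★ **RECEIPT (C-tab-opt) — gauge-free first-order optimality of the ROOTED response, at the record's names**: for every matrix entry `(i, i')`, the real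
and imaginary parts of the chart-unit-rescaled rooted response `ξ⁻¹·recordD a l · i i'` are WEAKLY CRITICAL for the global linearised problem with datum the
matching part of `ρ₈(bV a)_{ii'}·e_l` — print's (178) p.306 linearised at the flat point (the derivative in `B` at `0`, under [15] Prop. 9's analyticity
clause = P0∕HypAn, of the first-order optimality of the (0.21) minimiser on the constraint surface).  OPEN·M mod P0; NOT asserted, NOT discharged here;
the datum's colour scalar follows DEF-1's `unitField` normalisation (DEF-1's call). [cite: Balaban1985Variational, (178) p.306, Prop. 9 p.309; Balaban1987RG1, (4.35) p.290] -/
def RootedResponseWeaklyCriticalAt (k K : ℕ) (a : θ.ιβ) (l : RespLabel F k K) : Prop :=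
  letI := θ.instVβ₁; letI := θ.instVβ₂
  ∀ hk : k + 1 ≤ (F.P K).m + (F.P K).K, ∀ i i' : Fin 2,
    WeaklyCritical (univDomains F k K hk) 1 ((θ.ρ8 (θ.bV a) i i').re • windowSrc F k K hk Finset.univ l)
        (reBond F K fun b => (((F.P K).eta (k + 1))⁻¹ : ℂ) * recordD F θ k K a l b i i') ∧
      WeaklyCritical (univDomains F k K hk) 1 ((θ.ρ8 (θ.bV a) i i').im • windowSrc F k K hk Finset.univ l)
        (imBond F K fun b => (((F.P K).eta (k + 1))⁻¹ : ℂ) * recordD F θ k K a l b i i')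


/-- ★★★ **THE 𝐔-CORE OF (C-tab) FROM (C-tab-opt)**: if the rooted response is weakly critical (receipt above), then ENTRYWISE it equals DEF-1's chart-unit
localized response at the window `univ` (`recordHrLocξ univ = ξ·windowResp univ l·ρ₈(bV a)`) PLUS `ξ` times a complex lattice gradient of restricted-gauge
potentials — i.e. «rooted response − `H₁e_l` is a pure gauge», print's (176) + (21) ↔ [B6] (2.12)∕(2.35).  What (C-tab) needs beyond this: the Landau
re-dressing `recordHr = landauRepC ∘ recordD` shifts by another gradient (BIJ85 (4.42), by construction), `sl2Coord` is linear (𝐔-rows), and the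
linearised current kills gradients (𝐉-rows) — bookkeeping, not typed here. [cite: Balaban1985Variational, (176) p.306, (21) p.281; Balaban1984PropagatorsII, (2.12) p.225, (2.35) p.228; Balaban1987RG1, (4.35) p.290] -/
theorem recordD_sub_recordHrLocξ_univ_of_weaklyCritical (k K : ℕ) (hk : k + 1 ≤ (F.P K).m + (F.P K).K) (a : θ.ιβ)
    (l : RespLabel F k K) (h : RootedResponseWeaklyCriticalAt F θ k K a l) (i i' : Fin 2) :
    ∃ n m : ScalarSpace (F.P K), n ∈ LinearMap.ker (QpE (univDomains F k K hk)) ∧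
      m ∈ LinearMap.ker (QpE (univDomains F k K hk)) ∧
      ∀ b, recordD F θ k K a l b i i' - recordHrLocξ F θ k K Finset.univ a l b i i' =
        ((F.P K).eta (k + 1) : ℂ) * ((WithLp.ofLp (dE 1 n) b : ℂ) + (WithLp.ofLp (dE 1 m) b : ℂ) * Complex.I) := by
  letI := θ.instVβ₁; letI := θ.instVβ₂
  obtain ⟨hre, him⟩ := h hk i i'
  obtain ⟨n, hn, hre'⟩ := (weaklyCritical_univ_iff F k K hk l _ _).mp hre
  obtain ⟨m, hm, him'⟩ := (weaklyCritical_univ_iff F k K hk l _ _).mp him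
  refine ⟨n, m, hn, hm, fun b => ?_⟩
  set ξ : ℝ := (F.P K).eta (k + 1) with hξ
  have hξ0 : (ξ : ℂ) ≠ 0 := by exact_mod_cast (pow_pos (inv_pos.mpr (Nat.cast_pos.mpr (F.P K).L_pos)) (k + 1) : 0 < (F.P K).eta (k + 1)).ne'
  set z : ℂ := ((ξ : ℂ)⁻¹) * recordD F θ k K a l b i i' with hz
  have h1 := hre' b
  have h2 := him' b
  simp only [WithLp.ofLp_sub, Pi.sub_apply, reBond, imBond] at h1 h2
  have hzre : z.re = (θ.ρ8 (θ.bV a) i i').re * windowResp F k K Finset.univ l b + WithLp.ofLp (dE 1 n) b := by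
    rw [hz]; linarith
  have hzim : z.im = (θ.ρ8 (θ.bV a) i i').im * windowResp F k K Finset.univ l b + WithLp.ofLp (dE 1 m) b := by
    rw [hz]; linarith
  have hD : recordD F θ k K a l b i i' = (ξ : ℂ) * z := by
    rw [hz, ← mul_assoc, mul_inv_cancel₀ hξ0, one_mul]
  have hH : recordHrLocξ F θ k K Finset.univ a l b i i' = ((ξ * windowResp F k K Finset.univ l b : ℝ) : ℂ) * θ.ρ8 (θ.bV a) i i' := by
    simp only [recordHrLocξ, windowRespξ, hξ]
  rw [hD, hH]
  apply Complex.ext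
  · simp only [Complex.sub_re, Complex.mul_re, Complex.ofReal_re, Complex.ofReal_im, Complex.add_re, Complex.add_im,
      Complex.mul_im, Complex.I_re, Complex.I_im, hzre, hzim]
    ring
  · simp only [Complex.sub_im, Complex.mul_re, Complex.ofReal_re, Complex.ofReal_im, Complex.add_re, Complex.add_im,
      Complex.mul_im, Complex.I_re, Complex.I_im, hzre, hzim]
    ring

end Record

/-! ## §6 (v1.1, append-only)  (bk-1): the (21)-Landau re-dressing is a gradient shift, hence `recordHr − recordHrLocξ univ` is a complex gradient entrywise -/

section Landau

open Summit.QuantumFields.YangMills.Theorems.K0RecordFormatNames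
open Literature.MathematicalPhysics.QuantumFieldTheory.Balaban1983to89.T4Continuum (T4Family)
open Literature.MathematicalPhysics.QuantumFieldTheory.Balaban1983to89.Node00

variable (F : T4Family)

/-- **(bk-1) THE LANDAU RE-DRESSING IS A GRADIENT SHIFT** (by DEF-1's definition `landauRep x = x − ∂(landauPot x)`, real and imaginary parts separately; `∂ = dE 1 =
gradV1 _ 1`, ✓`B6SectAWholeTorusBridge.dE_eq_gradV1`). [cite: Balaban1985Variational, (21) p.281; Balaban1984PropagatorsII, (2.12) p.225] -/
theorem landauRepC_eq_sub_grad (k K : ℕ) (x : PBond (F.P K) 0 → ℂ) (b : PBond (F.P K) 0) :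
    landauRepC F k K x b = x b -
      (((WithLp.ofLp (dE 1 (landauPot F k K (reBond F K x))) b : ℝ) : ℂ) +
        ((WithLp.ofLp (dE 1 (landauPot F k K (imBond F K x))) b : ℝ) : ℂ) * Complex.I) := by
  have hx : x b = ((x b).re : ℂ) + ((x b).im : ℂ) * Complex.I := (Complex.re_add_im (x b)).symm
  rw [hx]
  simp only [landauRepC, landauRep, B6SectAWholeTorusBridge.dE_eq_gradV1, WithLp.ofLp_sub, Pi.sub_apply, reBond, imBond,
    Complex.ofReal_sub]
  ring

variable (θ : Stage13Params F 2)

/-- ★★★ **`recordHr − recordHrLocξ univ` IS A COMPLEX LATTICE GRADIENT, ENTRYWISE, given the receipt (C-tab-opt)** — §5 composed with (bk-1): the L-table's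
`Hr = landauRepC ∘ recordD` and DEF-1's chart-unit localized response at the window `univ` differ, in every matrix entry, by `∂Ψ_re + i·∂Ψ_im` for site potentials
`Ψ_re Ψ_im : Fin 2 → Fin 2 → ℓ²(sites)`.  What is left of (C-tab) after this: `sl2Coord`-linearity on the 𝐔-rows (bk-2) and the 𝐉-rows (bk-3).
[cite: Balaban1985Variational, (176) p.306, (21) p.281, Prop. 9 p.309; Balaban1984PropagatorsII, (2.12) p.225, (2.35) p.228; Balaban1987RG1, (4.35) p.290] -/
theorem recordHr_sub_recordHrLocξ_univ_of_weaklyCritical (k K : ℕ) (hk : k + 1 ≤ (F.P K).m + (F.P K).K) (a : θ.ιβ)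
    (l : RespLabel F k K) (h : RootedResponseWeaklyCriticalAt F θ k K a l) :
    ∃ Ψre Ψim : Fin 2 → Fin 2 → ScalarSpace (F.P K), ∀ b i i',
      recordHr F θ k K a l b i i' - recordHrLocξ F θ k K Finset.univ a l b i i' =
        ((WithLp.ofLp (dE 1 (Ψre i i')) b : ℝ) : ℂ) + ((WithLp.ofLp (dE 1 (Ψim i i')) b : ℝ) : ℂ) * Complex.I := by
  choose n m hn hm hD using fun i i' => recordD_sub_recordHrLocξ_univ_of_weaklyCritical F θ k K hk a l h i i'
  refine ⟨fun i i' => (F.P K).eta (k + 1) • n i i' - landauPot F k K (reBond F K fun b' => recordD F θ k K a l b' i i'),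
    fun i i' => (F.P K).eta (k + 1) • m i i' - landauPot F k K (imBond F K fun b' => recordD F θ k K a l b' i i'),
    fun b i i' => ?_⟩
  have h1 : recordHr F θ k K a l b i i' = landauRepC F k K (fun b' => recordD F θ k K a l b' i i') b := rfl
  rw [h1, landauRepC_eq_sub_grad, sub_right_comm, hD i i' b]
  simp only [map_sub, map_smul, WithLp.ofLp_sub, WithLp.ofLp_smul, Pi.sub_apply, Pi.smul_apply, smul_eq_mul,
    Complex.ofReal_sub, Complex.ofReal_mul]
  ring

end Landau

/-! ## §7 (v1.2, append-only)  (bk-2): THE 𝐔-ROWS OF (C-tab) FROM THE RECEIPT — `sl2Coord`-linearity + the two-block indexing; `recordGradLeg` = ✓p813155's name of record -/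

section URows

open Summit.QuantumFields.YangMills.Theorems.K0RecordFormatNames
open Summit.QuantumFields.YangMills.Theorems.K0AxGaugeFlowRec (recordGradLeg)
open Literature.MathematicalPhysics.QuantumFieldTheory.Balaban1983to89.T4Continuum (T4Family)
open Literature.MathematicalPhysics.QuantumFieldTheory.Balaban1983to89.Node00


variable (F : T4Family) (θ : Stage13Params F 2)

/-- ★★★ **(C-tab) ON THE 𝐔-ROWS, FROM THE RECEIPT (C-tab-opt)**: for every label `l` there is ONE site potential `φ : sites → ℂ³` with, for every fine bond `b`
and colour `c`, `recordGkL a l (b, 𝐔_c) − recordGkLocWξ univ a l (b, 𝐔_c) = recordGradLeg φ (b, 𝐔_c)` — the L-table and DEF-1's transverse table agree on the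
`𝐔`-block up to the pure-gauge leg of record (§6 + `sl2Coord`-linearity; `φ := −sl2Coord ∘ (Ψ_re + iΨ_im)`).  LEFT of (C-tab) = `TableRowLT`: the `𝐉`-rows (bk-3).
[cite: Balaban1985Variational, (176) p.306, (21) p.281, Prop. 9 p.309; Balaban1984PropagatorsII, (2.12) p.225, (2.35) p.228; Balaban1987RG1, (4.35) p.290, (4.8) p.283] -/
theorem tableRowLT_urows_of_weaklyCritical (k K : ℕ) (hk : k + 1 ≤ (F.P K).m + (F.P K).K) (a : θ.ιβ) (l : RespLabel F k K)
    (h : RootedResponseWeaklyCriticalAt F θ k K a l) :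
    ∃ φ : Site (F.P K) 0 → Fin 3 → ℂ, ∀ (b : PBond (F.P K) 0) (c : Fin 3),
      recordGkL F θ k K a l (chartEquivJ F K (b, Sum.inl c)) -
          recordGkLocWξ F θ k K Finset.univ a l (chartEquivJ F K (b, Sum.inl c)) =
        recordGradLeg F K φ (chartEquivJ F K (b, Sum.inl c)) := by
  obtain ⟨Ψre, Ψim, hΨ⟩ := recordHr_sub_recordHrLocξ_univ_of_weaklyCritical F θ k K hk a l h
  let M : Site (F.P K) 0 → MatA 2 := fun y =>
    Matrix.of fun i i' => ((WithLp.ofLp (Ψre i i') y : ℝ) : ℂ) + ((WithLp.ofLp (Ψim i i') y : ℝ) : ℂ) * Complex.I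
  refine ⟨fun y c => -sl2Coord (M y) c, fun b c => ?_⟩
  have hG : (Matrix.of fun i i' => recordHr F θ k K a l b i i') -
      (Matrix.of fun i i' => recordHrLocξ F θ k K Finset.univ a l b i i') = M b.tgt - M b.src := by
    ext i i'
    simp only [Matrix.sub_apply, Matrix.of_apply, hΨ b i i', ofLp_dE, LatticeFieldCalculus.grad, one_smul, M,
      Complex.ofReal_sub]
    ring
  have key : sl2Coord (Matrix.of fun i i' => recordHr F θ k K a l b i i') c -
      sl2Coord (Matrix.of fun i i' => recordHrLocξ F θ k K Finset.univ a l b i i') c =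
        sl2Coord (M b.tgt) c - sl2Coord (M b.src) c := by
    rw [← Pi.sub_apply (sl2Coord _) (sl2Coord _) c, ← K0AxGaugeFlowRec.sl2Coord_sub, hG, K0AxGaugeFlowRec.sl2Coord_sub, Pi.sub_apply]
  simp only [recordGkL, recordGkLocWξ, recordGradLeg, Equiv.symm_apply_apply, Sum.elim_inl]
  rw [key]
  ring

end URows

end

end Summit.QuantumFields.YangMills.Theorems.K0AxCtabUniq
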